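import Summits.QuantumFields.BalabanUV.Beta.FP.CoarseInverseScalar
import Literature.MathematicalPhysics.QuantumFieldTheory.Balaban1983to89.Beta.PoissonInterior

/-!
# `BalabanUV.Beta.FP.ScalarMinimiserLetters` — road «FP» (binder row D1), row **GAMMA-9 (I-gh)** «THE SCALAR MINIMISER's (I) LETTER»:
# the n-FREE sup letter and the n⁻¹ unit-difference letter of the columns of the scalar constrained minimiser
# `𝓘_gh = minOp(Δ, Q′) = G′Q′*(Q′G′Q′*)⁻¹` on `ℤ^d` (pv23's `B5Hk103ScalarZd.kerH`), by ELLIPTIC REGULARITY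
# (`Beta/PoissonInterior.interior_estimate`) over the ℓ²∕Combes–Thomas block decay (`kerH_blockRMS_le`)

HONEST DEPENDENCY (page 1, mandatory): continuum YM on T⁴ ⇐ BetaPertH ∧ nine spine estimates (0/9 proved); BetaPertH ⇐ (D1) ∧ (D4) ∧
CAP+tail; G-an2-4 gates asym, D1 and NE2/3/4.  HONEST FRAMING (cell contract, verbatim): «discharging `BetaPertH` makes Bałaban's UV
stability UNCONDITIONAL — a real constructive-QFT result; it is NOT the continuum limit and NOT the Clay problem.»  THIS MODULE is [folklore]
lattice bookkeeping over TWO TREE CERTIFICATES BY NAME — pv23's whole-lattice scalar minimiser `B5Hk103ScalarZd` (`kerH`, `abs_sum_mul_kerH_le`,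
`tsum_lap_mul_kerH`, `tsum_lapKer_mul`, `abs_Kinv_le`) and pv23's interior estimate for the lattice Poisson equation `Beta/PoissonInterior`
(`interior_estimate`, `cube`) — plus `B6QGQLower276`∕`B6QGQDecay237` block geometry (`B`, `blk`, `chart`, `dist_blk_ge`, `B_disjoint`, `mem_U`)
and `CoarseInverseScalar.dist_eq_supNorm`; no `def`, no `def … : Prop`, nothing cited, 0 sorry.  It asserts NOTHING about Bałaban's printed
(vector, axial-gauge) `H_k`: the object is the SCALAR analogue on `ℤ^d` (pv23's honest scope (i)–(ii)), which is the constrained-ghost minimiser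
of the road's organisation γ at zero background.  NOT (GH-a), NOT `hbook`, NOT D1, NOT BetaPertH, NOT continuum, NOT Clay.

ABSOLUTE RULE (cell charter, verbatim): «No internally-minted statement may enter as a cited fact. Every hypothesis is either kernel-proved in this
package or a verbatim quotation of a PUBLISHED theorem with page reference. The manuscript(s) under audit are NOT citable for their own disputed
steps — they are the thing under adjudication; programme-internal (2001/route/tribunal) claims are never citable.»

WHY (R-FP-28 (d), `LEAVES-FP.md` row GAMMA-9 (I-gh); N-d1leaf05g12-1).  The (GH-a) pieces (g4) «four scalar constraint loops» and (g5) «Gram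
loops» carry TWO legs `𝓘_gh` each and are power-counted by `MixLoopPowerCountingMass` with the leg letter (I)∕(J)
`|𝓘(b,v)| ≤ C·e^{−(δ∕N)‖b − N•v‖∞}`; the count is n-free only if `C` is.  The tree's letter for this object, pv23's `abs_kerH_le`, reads an
`ℓ²` Combes–Thomas bound at a point source and carries `(n+1)^{d∕2}` (pv23's honest scope (iii): «NO sup-norm O(1) entry bound for H(p,y) is
claimed (that needs elliptic regularity)»).  The elliptic regularity IS in the tree (pv23 gen 4, `PoissonInterior`, whose header names exactly
this application as «a SEPARATE module … NOT claimed here»); this file is that module.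

THE ARGUMENT (all `d ≥ 3`, `a > 0`, `N = n+1`, `D := ‖blk x − y‖∞`).  `u := kerH n a (·) y` satisfies
 (Δ)  `Δu(r) = −N⁻²·[(Q′G′Q′*)⁻¹(blk r, y) − a·δ_{blk r,y}]` (`tsum_lap_mul_kerH` + the three-point bridge `tsum_lapKer_mul` to lit1's
      `latticeLaplacianZd`), so `|Δu| ≤ (c_inv + a)·N⁻²·e^{3δ_inv}·e^{−δ_inv D}` on `cube x (3N)` (`abs_Kinv_le`; blocks met by the cube are
      within block distance 3 of `blk x`);
 (ℓ¹) `Σ_{B(y″)}|u| ≤ c_H·N^d·e^{−δ_H‖y″−y‖∞}` (`abs_sum_mul_kerH_le` against the sign pattern of the column), hence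
      `Σ_{cube x (3N)}|u| ≤ 7^d·c_H·N^d·e^{3δ_H}·e^{−δ_H D}` (the cube lies in the `7^d` blocks labelled by `cube (blk x) 3`);
 (I3) `PoissonInterior.interior_estimate` at `m = N`: `|u x| ≤ C(d)·(N²A + B∕N^d)`, `|u(x+e_j) − u x| ≤ C(d)·(NA + B∕N^{d+1})` — BOTH brackets
      are n-FREE multiples of `e^{−δ_H D}` (`δ_H ≤ δ_inv`).
CONTENT.  §1 (Δ); §2 (ℓ¹); §3 cube-versus-block geometry; §4 **`exists_kerH_letters`** (every `d ≥ 3`, `a`-dependence DISPLAYED): `∃ C₀ = C₀(d) ≥ 0, ∀ a > 0, ∀ n x y`,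
`|kerH n a x y| ≤ C₀·K(d,a)·e^{−δ_H‖blk x − y‖∞}` and `∀ j, |kerH n a (x + e_j) y − kerH n a x y| ≤ (C₀·K(d,a)∕(n+1))·e^{−δ_H‖blk x − y‖∞}`,
`K(d,a) = (c_inv + a)e^{3δ_inv} + 7^d c_H e^{3δ_H}`; `exists_kerH_letters_of_pos` (one `C(d,a)`); **`exists_kerH_letters_afree`** — since `kerH n a`
does not depend on `a` (pv23's `B5Hk103Unique.kerH_eq_kerH`), ONE `C(d)` and the rate `δ_H(d,1)` serve every `a > 0`;
the road's `d = 4` spelling on `Pt` — the (I)∕(J) shape `|𝓘(c,u)| ≤ C_I·e^{−(δ_H∕N)·‖c − N•u‖∞}` of `MixLoopPowerCountingMass` with `C_I`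
n-FREE, its unit-difference companion with the extra `N⁻¹`, and the (J′) coarse-moment letter — is the COMPANION `FP/ScalarMinimiserLettersPt`
(this file stays `d`-generic).  The constant is existential: it inherits lit1's existential Green-function constants through `PoissonInterior`
(fine for n-uniformity, useless for numerics — pv23's scope (iii) there).
COMPANION 2: `FP/ScalarMinimiserIdentification` — the identification `kerH n a p v = (n+1)^d·Σ'_y (Σ_{q∈B(y)} G₀(p−q))·coarseInv(y,v)` with (GH-a)'s
spelling `𝓘 = G₀Q′ᵀ𝔊_gh` (leaf-06's `CoarseInverseScalarSteps.freeCol_eq` + `CoarseInverseScalar.tsum_M_mul_coarseInv` + `B5Hk103Unique.kerH_eq_kerH`).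
NOT HERE: same-direction second differences (pv23's `PoissonInterior` scope (ii)); any torus version.
Provenance: unit `b2b-balaban-t4-ne7b-formalise-leaf-10` (gen 26, cross-cell idle-seat duty NE7b → FP), 2026-08-21; «not in print; our bookkeeping».
-/

noncomputable section

namespace Summit.QuantumFields.BalabanUV.Beta.FP.ScalarMinimiserLetters

open Finset Real
open scoped BigOperators
open Literature.Probability.LatticeModels (latticeLaplacianZd latticeLaplacianZd_def)
open Literature.MathematicalPhysics.QuantumFieldTheory.Balaban1983to89
open B6QGQLower276 (X e B blk chart side loc mem_B blk_chart chart_mem_B sum_B_const B_disjoint U mem_U lapKer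
  side_mul_blk_add_loc loc_nonneg loc_le)
open B6QGQDecay237 (cInv deltaInv cInv_pos deltaInv_pos dist_blk_ge)
open B5Hk103ScalarZd (Kinv kerH abs_Kinv_le abs_sum_mul_kerH_le tsum_lap_mul_kerH tsum_lapKer_mul cH deltaH cH_pos deltaH_pos)
open B5Hk103Unique (kerH_eq_kerH)
open Beta.PoissonInterior (cube mem_cube interior_estimate)

variable {d : ℕ}

/-! ## §1 The Laplacian of a minimiser column is `N⁻²` times a bounded block-constant function -/

/-- [folklore] lit1's Laplacian against pv23's three-point row: `Δh(p) = −Σ'_r (−Δ)(p,r)h(r)`. -/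
theorem latticeLaplacianZd_eq_neg_tsum_lapKer (h : X d → ℝ) (p : X d) :
    latticeLaplacianZd h p = -∑' r : X d, lapKer p r * h r := by
  rw [tsum_lapKer_mul, latticeLaplacianZd_def]
  simp only [e, Finset.sum_sub_distrib, Finset.sum_const, Finset.card_univ, Fintype.card_fin, nsmul_eq_mul,
    Finset.sum_add_distrib]
  ring

/-- **(Δ) the column's Poisson equation**: `Δ_p kerH(p,y) = −(n+1)⁻²·[(Q′G′Q′*)⁻¹(blk p, y) − a·δ_{blk p, y}]`. [folklore] -/
theorem lap_kerH (n : ℕ) {a : ℝ} (ha : 0 < a) (p y : X d) :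
    latticeLaplacianZd (fun r => kerH n a r y) p
      = -((Kinv n a (blk n p) y - a * (if blk n p = y then 1 else 0)) / ((n : ℝ) + 1) ^ 2) := by
  have hN : ((n : ℝ) + 1) ^ 2 ≠ 0 := by positivity
  have h := tsum_lap_mul_kerH n ha p y
  have h2 : ∑' r : X d, (((n : ℝ) + 1) ^ 2 * lapKer p r) * kerH n a r y
      = ((n : ℝ) + 1) ^ 2 * ∑' r : X d, lapKer p r * kerH n a r y := by
    rw [← tsum_mul_left]; exact tsum_congr fun r => by ring
  rw [latticeLaplacianZd_eq_neg_tsum_lapKer]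
  congr 1
  rw [eq_div_iff hN, ← h, h2]
  ring

/-- **(Δ) as a bound**: `|Δ_p kerH(p,y)| ≤ (c_inv + a)·(n+1)⁻²·e^{−δ_inv‖blk p − y‖∞}`. [folklore] -/
theorem abs_lap_kerH_le (n : ℕ) {a : ℝ} (ha : 0 < a) (p y : X d) :
    |latticeLaplacianZd (fun r => kerH n a r y) p|
      ≤ (cInv d a + a) / ((n : ℝ) + 1) ^ 2 * Real.exp (-(deltaInv d a * dist (blk n p) y)) := by
  have hN : (0 : ℝ) < ((n : ℝ) + 1) ^ 2 := by positivity
  rw [lap_kerH n ha, abs_neg, abs_div, abs_of_pos hN, div_mul_eq_mul_div]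
  refine div_le_div_of_nonneg_right ?_ hN.le
  have hK := abs_Kinv_le n ha (blk n p) y
  by_cases hpy : blk n p = y
  · rw [if_pos hpy]
    have h0 : dist (blk n p) y = 0 := by rw [hpy, dist_self]
    rw [h0, mul_zero, neg_zero, Real.exp_zero] at hK ⊢
    simp only [mul_one] at hK ⊢
    calc |Kinv n a (blk n p) y - a| ≤ |Kinv n a (blk n p) y| + |a| := abs_sub _ _
      _ ≤ cInv d a + a := by rw [abs_of_pos ha]; linarith
  · rw [if_neg hpy, mul_zero, sub_zero]
    refine hK.trans ?_
    have : 0 ≤ a * Real.exp (-(deltaInv d a * dist (blk n p) y)) := by positivity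
    nlinarith

/-! ## §2 The block `ℓ¹` mass of a minimiser column -/

/-- **(ℓ¹) block mass**: `Σ_{p∈B(y″)} |kerH(p,y)| ≤ c_H·(n+1)^d·e^{−δ_H‖y″ − y‖∞}` (pv23's `ℓ²` decay against the column's sign pattern).
[folklore] -/
theorem sum_B_abs_kerH_le (n : ℕ) {a : ℝ} (ha : 0 < a) (y'' y : X d) :
    ∑ p ∈ B n y'', |kerH n a p y| ≤ cH d a * ((n : ℝ) + 1) ^ d * Real.exp (-(deltaH d a * dist y'' y)) := by
  classical
  set v : X d → ℝ := fun p => if 0 ≤ kerH n a p y then 1 else -1 with hv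
  have hvk : ∀ p, v p * kerH n a p y = |kerH n a p y| := by
    intro p; simp only [hv]
    split_ifs with h
    · rw [one_mul, abs_of_nonneg h]
    · rw [neg_one_mul, abs_of_neg (not_le.1 h)]
  have hv2 : ∀ p, v p ^ 2 = 1 := by
    intro p; simp only [hv]; split_ifs <;> norm_num
  have h := abs_sum_mul_kerH_le n ha y'' y v
  simp_rw [hvk, hv2] at h
  rw [sum_B_const, mul_one, abs_of_nonneg (Finset.sum_nonneg fun p _ => abs_nonneg _)] at h
  have hs : Real.sqrt (((n : ℝ) + 1) ^ d) * Real.sqrt (((n : ℝ) + 1) ^ d) = ((n : ℝ) + 1) ^ d :=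
    Real.mul_self_sqrt (by positivity)
  calc ∑ p ∈ B n y'', |kerH n a p y|
      ≤ cH d a * Real.sqrt (((n : ℝ) + 1) ^ d) * Real.exp (-(deltaH d a * dist y'' y)) * Real.sqrt (((n : ℝ) + 1) ^ d) := h
    _ = cH d a * (Real.sqrt (((n : ℝ) + 1) ^ d) * Real.sqrt (((n : ℝ) + 1) ^ d)) * Real.exp (-(deltaH d a * dist y'' y)) := by
        ring
    _ = cH d a * ((n : ℝ) + 1) ^ d * Real.exp (-(deltaH d a * dist y'' y)) := by rw [hs]

/-! ## §3 Cube-versus-block geometry: the cube of radius `3(n+1)` about `x` meets only blocks within block distance `3` of `blk x` -/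

/-- [folklore] coordinates of block labels: `|blk r μ − blk x μ| ≤ 3` when `|r μ − x μ| ≤ 3(n+1)`. -/
theorem abs_blk_sub_blk_le {n : ℕ} {r x : X d} {μ : Fin d} (h : |r μ - x μ| ≤ ((3 * (n + 1) : ℕ) : ℤ)) :
    |blk n r μ - blk n x μ| ≤ 3 := by
  have h1 := side_mul_blk_add_loc n r μ
  have h2 := side_mul_blk_add_loc n x μ
  have l1 := loc_nonneg n r μ; have l2 := loc_le n r μ
  have l3 := loc_nonneg n x μ; have l4 := loc_le n x μ
  have hs : side n = (n : ℤ) + 1 := rfl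
  rw [hs] at h1 h2
  push_cast at h
  rw [abs_le] at h ⊢
  obtain ⟨ha, hb⟩ := h
  have hn0 : (0 : ℤ) ≤ (n : ℤ) + 1 := by positivity
  constructor
  · by_contra hc
    rw [not_le] at hc
    have hc' : blk n r μ - blk n x μ ≤ -4 := by omega
    nlinarith [mul_le_mul_of_nonneg_left hc' hn0]
  · by_contra hc
    rw [not_le] at hc
    have hc' : 4 ≤ blk n r μ - blk n x μ := by omega
    nlinarith [mul_le_mul_of_nonneg_left hc' hn0]

/-- [folklore] the cube of radius `3(n+1)` about `x` lies in the union of the blocks labelled by `cube (blk x) 3`. -/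
theorem cube_subset_U (n : ℕ) (x : X d) : cube x (3 * (n + 1)) ⊆ U n (cube (blk n x) 3) := by
  intro r hr
  rw [mem_U, mem_cube]
  rw [mem_cube] at hr
  intro μ
  exact_mod_cast abs_blk_sub_blk_le (hr μ)

/-- [folklore] block labels in `cube c 3` are within sup-distance `3` of `c`. -/
theorem dist_le_three_of_mem_cube {c y'' : X d} (h : y'' ∈ cube c 3) : dist c y'' ≤ 3 := by
  rw [mem_cube] at h
  refine (dist_pi_le_iff (by norm_num)).2 fun μ => ?_
  rw [Int.dist_eq, ← Int.cast_sub, ← Int.cast_abs, abs_sub_comm]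
  exact_mod_cast h μ

/-- [folklore] `card (cube c 3) = 7^d`. -/
theorem card_cube_three (c : X d) : (cube c 3).card = 7 ^ d := by
  unfold cube
  have h7 : ∀ i : Fin d, (Finset.Icc (c i - ((3 : ℕ) : ℤ)) (c i + ((3 : ℕ) : ℤ))).card = 7 := by
    intro i
    rw [Int.card_Icc, show c i + ((3 : ℕ) : ℤ) + 1 - (c i - ((3 : ℕ) : ℤ)) = 7 by push_cast; ring]
    rfl
  rw [Fintype.card_piFinset]
  simp only [h7, Finset.prod_const, Finset.card_univ, Fintype.card_fin]

/-- **(ℓ¹) on the cube**: `Σ_{r ∈ cube x (3(n+1))} |kerH(r,y)| ≤ 7^d·c_H·(n+1)^d·e^{3δ_H}·e^{−δ_H‖blk x − y‖∞}`. [folklore] -/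
theorem sum_cube_abs_kerH_le (n : ℕ) {a : ℝ} (ha : 0 < a) (x y : X d) :
    ∑ r ∈ cube x (3 * (n + 1)), |kerH n a r y|
      ≤ 7 ^ d * cH d a * ((n : ℝ) + 1) ^ d * Real.exp (3 * deltaH d a) * Real.exp (-(deltaH d a * dist (blk n x) y)) := by
  classical
  have hδ := (deltaH_pos d ha).le
  have hcH := (cH_pos d ha).le
  calc ∑ r ∈ cube x (3 * (n + 1)), |kerH n a r y|
      ≤ ∑ r ∈ U n (cube (blk n x) 3), |kerH n a r y| :=
        Finset.sum_le_sum_of_subset_of_nonneg (cube_subset_U n x) fun _ _ _ => abs_nonneg _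
    _ = ∑ y'' ∈ cube (blk n x) 3, ∑ r ∈ B n y'', |kerH n a r y| := by
        rw [U, Finset.sum_biUnion]
        intro y₁ _ y₂ _ hne
        exact B_disjoint hne
    _ ≤ ∑ y'' ∈ cube (blk n x) 3, cH d a * ((n : ℝ) + 1) ^ d * Real.exp (3 * deltaH d a)
          * Real.exp (-(deltaH d a * dist (blk n x) y)) := by
        refine Finset.sum_le_sum fun y'' hy'' => (sum_B_abs_kerH_le n ha y'' y).trans ?_
        have hd3 : dist (blk n x) y'' ≤ 3 := dist_le_three_of_mem_cube hy''
        have htri : dist (blk n x) y ≤ dist (blk n x) y'' + dist y'' y := dist_triangle _ _ _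
        have hexp : Real.exp (-(deltaH d a * dist y'' y))
            ≤ Real.exp (3 * deltaH d a) * Real.exp (-(deltaH d a * dist (blk n x) y)) := by
          rw [← Real.exp_add]
          exact Real.exp_le_exp.2 (by nlinarith)
        rw [mul_assoc (cH d a * ((n : ℝ) + 1) ^ d)]
        exact mul_le_mul_of_nonneg_left hexp (by positivity)
    _ = 7 ^ d * cH d a * ((n : ℝ) + 1) ^ d * Real.exp (3 * deltaH d a) * Real.exp (-(deltaH d a * dist (blk n x) y)) := by
        rw [Finset.sum_const, card_cube_three, nsmul_eq_mul]
        push_cast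
        ring

/-- **(Δ) on the cube**: `|Δ kerH(·,y)| ≤ (c_inv + a)·(n+1)⁻²·e^{3δ_inv}·e^{−δ_inv‖blk x − y‖∞}` on `cube x (3(n+1))`. [folklore] -/
theorem abs_lap_kerH_le_cube (n : ℕ) {a : ℝ} (ha : 0 < a) (x y : X d) {r : X d} (hr : r ∈ cube x (3 * (n + 1))) :
    |latticeLaplacianZd (fun p => kerH n a p y) r|
      ≤ (cInv d a + a) / ((n : ℝ) + 1) ^ 2 * Real.exp (3 * deltaInv d a) * Real.exp (-(deltaInv d a * dist (blk n x) y)) := by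
  have hδ := (deltaInv_pos d ha).le
  refine (abs_lap_kerH_le n ha r y).trans ?_
  have hU : r ∈ U n (cube (blk n x) 3) := cube_subset_U n x hr
  rw [mem_U] at hU
  have hd3 : dist (blk n x) (blk n r) ≤ 3 := dist_le_three_of_mem_cube hU
  have htri : dist (blk n x) y ≤ dist (blk n x) (blk n r) + dist (blk n r) y := dist_triangle _ _ _
  have hexp : Real.exp (-(deltaInv d a * dist (blk n r) y))
      ≤ Real.exp (3 * deltaInv d a) * Real.exp (-(deltaInv d a * dist (blk n x) y)) := by
    rw [← Real.exp_add]
    exact Real.exp_le_exp.2 (by nlinarith)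
  have hc : 0 ≤ (cInv d a + a) / ((n : ℝ) + 1) ^ 2 := by have := (cInv_pos d ha).le; positivity
  rw [mul_assoc]
  exact mul_le_mul_of_nonneg_left hexp hc

/-! ## §4 THE LETTERS (every `d ≥ 3`): n-free sup bound and `n⁻¹` unit differences of the minimiser columns, `a`-dependence displayed -/

/-- **THE SCALAR MINIMISER's (I) LETTER, n-FREE, and its unit-difference companion** (every `d ≥ 3`): there is a purely dimensional
`C₀ = C₀(d) ≥ 0` (pv23's `PoissonInterior.interior_estimate` constant — existential, from lit1's Green-function constants) such that for EVERY
mass parameter `a > 0`, EVERY blocking `n`, every fine site `x` and every block `y`, with the DISPLAYED `a`-dependence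
`K(d,a) := (c_inv(d,a) + a)·e^{3δ_inv(d,a)} + 7^d·c_H(d,a)·e^{3δ_H(d,a)}` (pv23's `B6QGQDecay237.cInv∕deltaInv`, `B5Hk103ScalarZd.cH∕deltaH`):
`|kerH n a x y| ≤ C₀·K(d,a)·e^{−δ_H(d,a)·‖blk x − y‖∞}` and `|kerH n a (x + e_j) y − kerH n a x y| ≤ (C₀·K(d,a)∕(n+1))·e^{−δ_H(d,a)·‖blk x − y‖∞}` —
pv23's `ℓ²`-route decay UPGRADED to the sup norm by the interior estimate (the factor `(n+1)^{d∕2}` of `abs_kerH_le` is gone). [folklore] -/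
theorem exists_kerH_letters (hd : 3 ≤ d) :
    ∃ C₀ : ℝ, 0 ≤ C₀ ∧ ∀ {a : ℝ}, 0 < a → ∀ (n : ℕ) (x y : X d),
      |kerH n a x y| ≤ C₀ * ((cInv d a + a) * Real.exp (3 * deltaInv d a) + 7 ^ d * cH d a * Real.exp (3 * deltaH d a))
          * Real.exp (-(deltaH d a * dist (blk n x) y)) ∧
      ∀ j : Fin d, |kerH n a (x + e j) y - kerH n a x y|
        ≤ C₀ * ((cInv d a + a) * Real.exp (3 * deltaInv d a) + 7 ^ d * cH d a * Real.exp (3 * deltaH d a)) / ((n : ℝ) + 1)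
          * Real.exp (-(deltaH d a * dist (blk n x) y)) := by
  obtain ⟨C₀, hC₀, hI⟩ := interior_estimate hd
  refine ⟨C₀, hC₀, fun {a} ha n x y => ?_⟩
  have hcI := (cInv_pos d ha).le
  have hcH := (cH_pos d ha).le
  set K : ℝ := (cInv d a + a) * Real.exp (3 * deltaInv d a) + 7 ^ d * cH d a * Real.exp (3 * deltaH d a) with hK
  have hK0 : 0 ≤ K := by positivity
  set N : ℝ := (n : ℝ) + 1 with hN
  have hN0 : 0 < N := by positivity
  have hN1 : (((n + 1 : ℕ) : ℝ)) = N := by push_cast; rfl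
  set D : ℝ := dist (blk n x) y with hD
  set EI := Real.exp (-(deltaInv d a * D)) with hEI
  set EH := Real.exp (-(deltaH d a * D)) with hEH
  -- `δ_H ≤ δ_inv`, so the (Δ)-term's exponential is dominated by the (ℓ¹)-term's
  have hEIH : EI ≤ EH := by
    rw [hEI, hEH]
    refine Real.exp_le_exp.2 (neg_le_neg (mul_le_mul_of_nonneg_right ?_ dist_nonneg))
    have h1 : deltaH d a ≤ deltaInv d a / 2 := by
      unfold deltaH; exact div_le_div_of_nonneg_right (min_le_right _ _) two_pos.le
    linarith [deltaInv_pos d ha]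
  set A : ℝ := (cInv d a + a) / N ^ 2 * Real.exp (3 * deltaInv d a) * EI with hA
  set Bm : ℝ := 7 ^ d * cH d a * N ^ d * Real.exp (3 * deltaH d a) * EH with hBm
  have hAub : ∀ r ∈ cube x (3 * (n + 1)), |latticeLaplacianZd (fun p => kerH n a p y) r| ≤ A :=
    fun r hr => abs_lap_kerH_le_cube n ha x y hr
  have hBub : ∑ r ∈ cube x (3 * (n + 1)), |kerH n a r y| ≤ Bm := sum_cube_abs_kerH_le n ha x y
  obtain ⟨hval, hgrad⟩ := hI (n + 1) (Nat.succ_pos n) (fun p => kerH n a p y) x A Bm hAub hBub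
  rw [hN1] at hval hgrad
  -- the two brackets are n-free multiples of `e^{−δ_H D}`
  have hbr1 : N ^ 2 * A + Bm / N ^ d ≤ K * EH := by
    have e1 : N ^ 2 * A = (cInv d a + a) * Real.exp (3 * deltaInv d a) * EI := by
      rw [hA]; field_simp
    have e2 : Bm / N ^ d = 7 ^ d * cH d a * Real.exp (3 * deltaH d a) * EH := by
      rw [hBm]; field_simp
    rw [e1, e2, hK, add_mul]
    have : (cInv d a + a) * Real.exp (3 * deltaInv d a) * EI ≤ (cInv d a + a) * Real.exp (3 * deltaInv d a) * EH :=
      mul_le_mul_of_nonneg_left hEIH (by positivity)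
    linarith
  have hbr2 : N * A + Bm / N ^ (d + 1) = (N ^ 2 * A + Bm / N ^ d) / N := by
    rw [hA, hBm]; field_simp; ring
  refine ⟨hval.trans ?_, fun j => (hgrad j).trans ?_⟩
  · calc C₀ * (N ^ 2 * A + Bm / N ^ d) ≤ C₀ * (K * EH) := mul_le_mul_of_nonneg_left hbr1 hC₀
      _ = C₀ * K * EH := by ring
  · rw [hbr2]
    calc C₀ * ((N ^ 2 * A + Bm / N ^ d) / N) ≤ C₀ * (K * EH / N) :=
          mul_le_mul_of_nonneg_left (div_le_div_of_nonneg_right hbr1 hN0.le) hC₀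
      _ = C₀ * K / N * EH := by field_simp

/-- **Corollary (one constant per `a`)**: `∃ C = C(d,a) ≥ 0, ∀ n x y`, `|kerH n a x y| ≤ C·e^{−δ_H‖blk x − y‖∞}` and
`|kerH n a (x + e_j) y − kerH n a x y| ≤ (C∕(n+1))·e^{−δ_H‖blk x − y‖∞}`. [folklore] -/
theorem exists_kerH_letters_of_pos (hd : 3 ≤ d) {a : ℝ} (ha : 0 < a) :
    ∃ C : ℝ, 0 ≤ C ∧ ∀ (n : ℕ) (x y : X d),
      |kerH n a x y| ≤ C * Real.exp (-(deltaH d a * dist (blk n x) y)) ∧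
      ∀ j : Fin d, |kerH n a (x + e j) y - kerH n a x y|
        ≤ C / ((n : ℝ) + 1) * Real.exp (-(deltaH d a * dist (blk n x) y)) := by
  obtain ⟨C₀, hC₀, h⟩ := exists_kerH_letters hd
  have hcI := (cInv_pos d ha).le
  have hcH := (cH_pos d ha).le
  exact ⟨C₀ * ((cInv d a + a) * Real.exp (3 * deltaInv d a) + 7 ^ d * cH d a * Real.exp (3 * deltaH d a)),
    by positivity, fun n x y => h ha n x y⟩

/-- **`a`-FREE FORM**: `kerH n a` does not depend on `a` (pv23's `B5Hk103Unique.kerH_eq_kerH` — the minimiser is the minimiser, the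
penalisation `a` only organises its construction), so ONE constant `C = C(d)` and ONE rate `δ_H(d,1)` serve EVERY `a > 0` and EVERY `n`:
`|kerH n a x y| ≤ C·e^{−δ_H(d,1)‖blk x − y‖∞}`, `|kerH n a (x + e_j) y − kerH n a x y| ≤ (C∕(n+1))·e^{−δ_H(d,1)‖blk x − y‖∞}`. [folklore] -/
theorem exists_kerH_letters_afree (hd : 3 ≤ d) :
    ∃ C : ℝ, 0 ≤ C ∧ ∀ {a : ℝ}, 0 < a → ∀ (n : ℕ) (x y : X d),
      |kerH n a x y| ≤ C * Real.exp (-(deltaH d 1 * dist (blk n x) y)) ∧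
      ∀ j : Fin d, |kerH n a (x + e j) y - kerH n a x y|
        ≤ C / ((n : ℝ) + 1) * Real.exp (-(deltaH d 1 * dist (blk n x) y)) := by
  obtain ⟨C, hC, h⟩ := exists_kerH_letters_of_pos hd one_pos
  refine ⟨C, hC, fun {a} ha n x y => ?_⟩
  rw [kerH_eq_kerH n ha one_pos]
  exact h n x y

end Summit.QuantumFields.BalabanUV.Beta.FP.ScalarMinimiserLetters

end
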